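import Summits.Ventures.CertifiedManyBodySolver.Certificates.HubRm2uTierP.Head
import Summits.Ventures.CertifiedManyBodySolver.Certificates.HubRm2uTierP.Hints001

/-!
# tier-P instance (HubRm2u-R13-W3) — chain file 1 of 96: steps 0..4 (topology (B): eval%-chained accumulators, no literals, import-serial)

Generated by hubbard-algo-p2's untrusted exporter (emit_v0.py + emit_w3.py); every datum below is re-derived / re-checked by the kernel chain
(`stepEQA`, Rows/CorrWindowCertKernelChainQuotAdj.lean) or is inert. HONEST FRAMING (xx1): instance data / kernel replay of a CONTROL/CALIBRATION
certificate (hub-Rm2-u′, 4^40-dyadic two-level Gram factors); nothing here is a theorem about the Hubbard model; no summit statement. [cite: Han2020Bootstrap, §3]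
-/

set_option linter.style.longLine false
set_option maxRecDepth 100000
set_option maxHeartbeats 0

namespace Summit.Ventures.CertifiedManyBodySolver
namespace CARPolyWindow.TierP.HubRm2u
open Summit.Ventures.CertifiedQuantumChemistry Summit.Ventures.CertifiedQuantumChemistry.CARPoly
open Literature.MathematicalPhysics.QuantumLattice Literature.MathematicalPhysics.QuantumLattice.HubbardWave0
open Literature.Probability.LatticeModels
open CARPolyWindow CARPolyWindow.BoxGeom

/-- accumulator after step 1 (evaluated at elaboration; the kernel re-derives it in `step_0`). [folklore] -/
def C1 : SOSDual.EncPoly := eval% stepEQA D 2048 C0 (slices.getD 0 []) (hintsOfCodes Dr reps HC0)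

/-- KERNEL FACT, step 0 of 350. [folklore] -/
theorem step_0 : C1 = stepEQA D 2048 C0 (slices.getD 0 []) (hintsOfCodes Dr reps HC0) :=
  eq_of_beq (by decide +kernel)

/-- accumulator after step 2 (evaluated at elaboration; the kernel re-derives it in `step_1`). [folklore] -/
def C2 : SOSDual.EncPoly := eval% stepEQA D 2048 C1 (slices.getD 1 []) (hintsOfCodes Dr reps HC1)

/-- KERNEL FACT, step 1 of 350. [folklore] -/
theorem step_1 : C2 = stepEQA D 2048 C1 (slices.getD 1 []) (hintsOfCodes Dr reps HC1) :=
  eq_of_beq (by decide +kernel)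

/-- accumulator after step 3 (evaluated at elaboration; the kernel re-derives it in `step_2`). [folklore] -/
def C3 : SOSDual.EncPoly := eval% stepEQA D 2048 C2 (slices.getD 2 []) (hintsOfCodes Dr reps HC2)

/-- KERNEL FACT, step 2 of 350. [folklore] -/
theorem step_2 : C3 = stepEQA D 2048 C2 (slices.getD 2 []) (hintsOfCodes Dr reps HC2) :=
  eq_of_beq (by decide +kernel)

/-- accumulator after step 4 (evaluated at elaboration; the kernel re-derives it in `step_3`). [folklore] -/
def C4 : SOSDual.EncPoly := eval% stepEQA D 2048 C3 (slices.getD 3 []) (hintsOfCodes Dr reps HC3)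

/-- KERNEL FACT, step 3 of 350. [folklore] -/
theorem step_3 : C4 = stepEQA D 2048 C3 (slices.getD 3 []) (hintsOfCodes Dr reps HC3) :=
  eq_of_beq (by decide +kernel)

/-- accumulator after step 5 (evaluated at elaboration; the kernel re-derives it in `step_4`). [folklore] -/
def C5 : SOSDual.EncPoly := eval% stepEQA D 2048 C4 (slices.getD 4 []) (hintsOfCodes Dr reps HC4)

/-- KERNEL FACT, step 4 of 350. [folklore] -/
theorem step_4 : C5 = stepEQA D 2048 C4 (slices.getD 4 []) (hintsOfCodes Dr reps HC4) :=
  eq_of_beq (by decide +kernel)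


end CARPolyWindow.TierP.HubRm2u
end Summit.Ventures.CertifiedManyBodySolver
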